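import Mathlib.Data.Matrix.Block
import Mathlib.Data.Matrix.Mul
import Mathlib.LinearAlgebra.Matrix.Determinant.Basic
import Mathlib.LinearAlgebra.Matrix.NonsingularInverse
import Mathlib.LinearAlgebra.Matrix.SchurComplement
import Mathlib.LinearAlgebra.Matrix.ToLin
import Mathlib.Tactic.Module
import HarnessLib

/-!
# Milne 1999 §6 «Some linear algebra»: the matrix `A(n, d)`, PROPOSITION 6.5 (row reduction over `ℤ`) and COROLLARY 6.6 (its
# kernel when `d(2 − nd) ≠ 0`) (J. S. Milne, *Lefschetz motives and the Tate conjecture*, Compositio Math. 117 (1999), §6 pp. 67–68)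

Family `hodge`, lane `lit-hodgefound` (Layer A3; seat `lit-hodgefound-p27`, generation 17, row g17-#1); topic
`Literature/NumberTheory/ComplexMultiplication` (kept with the seat's Milne-1999 series: this is the piece of matrix algebra that the
completion of the proof of THEOREM 6.1 (`P = L ∩ S`), LEMMA 6.7, runs on), namespace
`Literature.NumberTheory.ComplexMultiplication.BlockOnesMatrix`.  Pure matrix algebra, self-contained (Mathlib only): definitions with
bodies + THEOREMS; no named fact (D-0026, net debt 0).  Stated over a commutative ring `R` with the index set a finite type `ι`, `n = |ι|`
(Milne: `R = ℤ`, `ι = {1, …, n}`); the printed `ℤ^{2n}` instance of Corollary 6.6 is `int_matA_mulVec_eq_zero_iff`.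

THE PRINT.  [Milne1999] §6 p. 67 L31 – p. 68 L22 (held `paper:doi-10-1023-a-1000776613765` p0023–p0024), verbatim: «SOME LINEAR ALGEBRA.  For
`n ⩾ 1` and `d ∈ ℤ`, let `A(n, d)` be the `2n × 2n` matrix `( I_n , dE_n − I_n ; dE_n − I_n , I_n )` where `I_n` is the `n × n` identity matrix
and `E_n` is the `n × n` matrix with all entries equal to `1`.  PROPOSITION 6.5. The matrix `A(n, d)` is row equivalent over `ℤ` to
`( I_n , dE_n − I_n ; 0 , B )`, `B =` [the `n × n` matrix with first row `(2d − nd², 2d − nd², …, 2d − nd²)` and all other rows `0`].  Proof.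
After a set of row operations to reduce the block at lower-left to zero, `A(n, d)` becomes `( I_n , dE_n − I_n ; 0 , (2d − nd²)E_n )`, which
is obviously row-equivalent to the desired matrix.  COROLLARY 6.6. Assume `d(2 − nd) ≠ 0`. Then the kernel of the map
`x ↦ A(n, d)x : ℤ^{2n} → ℤ^{2n}` is the set of vectors of the form `(a_1, …, a_n, b_1, …, b_n)`, `a_i = b_i` for `1 ⩽ i ⩽ n`, `Σ a_i = 0`.
Proof. For an element `(x_1, …, x_{2n})` of the kernel, we may assign arbitrary values, say `b_2, …, b_n` to `x_{n+2}, …, x_{2n}`. Then the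
`(n + 1)`st equation becomes `x_{n+1} + Σ_{i=2}^{n} b_i = 0`, and so `b_1` is determined by the equation `Σ_{i=1}^{n} b_i = 0`. Now the first `n`
equations show that `x_i = − Σ_{j=n+1}^{2n} d x_{j} + x_{i+n} = b_i`, `1 ⩽ i ⩽ n`.  This proves the statement.»

DICTIONARY.  `ones = E_n` (`Matrix.of fun _ _ => 1`); `offBlock d = dE_n − I_n`; `matA d = A(n, d)` as `Matrix.fromBlocks` on `ι ⊕ ι` (first
summand = the `a`-coordinates `x_1, …, x_n`, second = the `b`-coordinates `x_{n+1}, …, x_{2n}`); `matB d i₀ = B` with `i₀ : ι` the «first» index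
(Milne's `n ⩾ 1`).  «Row equivalent over `ℤ`» = obtained by elementary row operations = `P · A(n, d)` for a unimodular `P`; here the two sets of
row operations of the printed proof are the explicit unimodular matrices `lowerClear d = ( I , 0 ; −(dE − I) , I )` («reduce the block at
lower-left to zero») and `rowCollapse i₀` («obviously»: subtract row `i₀` of the lower block from its other rows), `reducer d i₀` their product
(`det = 1`).  Corollary 6.6 is proved directly from the `2n` equations `matA_mulVec` (add the `i`-th equations of the two blocks:
`d(Σa + Σb) = 0`; sum the first block: `(2 − nd)Σa = 0`) rather than by back-substitution in the reduced matrix — the statement is as printed,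
over any commutative ring without zero divisors.

WHAT IS HERE (all PROVED): DEF `ones` (`ones_apply`, `ones_mul_ones : E·E = n•E`, `ones_mulVec`), DEF `offBlock` (`offBlock_mul_offBlock :
(dE − I)² = (nd² − 2d)E + I`), DEF **`matA`**, DEF `matB`; **PROPOSITION 6.5**: DEF `lowerClear` (`det_lowerClear`), **`lowerClear_mul_matA`** (the
printed intermediate form `( I , dE − I ; 0 , (2d − nd²)E )`), DEF `rowCollapse` (`det_rowCollapse`, `rowCollapse_mul_smul_ones`), DEF `reducer`
(`det_reducer`, `isUnit_reducer`), **`reducer_mul_matA`**, **`matA_rowEquiv`**; **COROLLARY 6.6**: `matA_mulVec` (the `2n` equations),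
**`matA_mulVec_eq_zero_iff`**, `matA_mulVec_eq_zero_iff'` («vectors of the form `(a, a)` with `Σ a_i = 0`»), DEF `kerSubmodule` +
**`ker_mulVecLin_matA`**, and the `ℤ^{2n}` instance **`int_matA_mulVec_eq_zero_iff`**.

NOT here: the use in LEMMA 6.7 (the composite `ℤ[Γ/D] → X^*(L^Π) → X^*(P^K) → ℤ[Γ/D]` has matrix `A(n/d, d)`), LEMMAS 6.8–6.10 and the
completion of the proof of THEOREM 6.1 — later rows / Layer B (B5-09).

## References

* [Milne1999] J. S. Milne, *Lefschetz motives and the Tate conjecture*, Compositio Math. 117 (1999) 45–76 — §6 «Some linear algebra»,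
  Proposition 6.5, Corollary 6.6, pp. 67–68 (held `paper:doi-10-1023-a-1000776613765` p0023 L73–L80, p0024 L1–L22).

Provenance: lane `lit-hodgefound`, seat `lit-hodgefound-p27` gen 17 (agent `literature-prover-lit-hodgefound-p27-g17-0`), row g17-#1.
-/

set_option autoImplicit false

namespace Literature.NumberTheory.ComplexMultiplication

namespace BlockOnesMatrix

open Matrix

variable {ι : Type*} {R : Type*} [CommRing R]

/-! ### The matrices `E_n`, `dE_n − I_n`, `A(n, d)`, `B` -/

/-- **`E_n`**: «the `n × n` matrix with all entries equal to `1`» (index set any finite type `ι`). [cite: Milne1999, §6 p. 68 («Some linear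
algebra»)] -/
def ones : Matrix ι ι R := Matrix.of fun _ _ => 1

/-- Entries of `E_n`. [cite: Milne1999, §6 p. 68 («Some linear algebra»)] -/
@[simp] theorem ones_apply (i j : ι) : (ones : Matrix ι ι R) i j = 1 := rfl

/-- `E_n · E_n = n E_n`. [cite: Milne1999, §6 p. 68 (proof of Proposition 6.5)] -/
theorem ones_mul_ones [Fintype ι] : (ones : Matrix ι ι R) * ones = (Fintype.card ι : R) • (ones : Matrix ι ι R) := by
  ext i j
  simp [Matrix.mul_apply, Finset.sum_const, Finset.card_univ, nsmul_eq_mul]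

/-- `E_n x = (Σ_j x_j, …, Σ_j x_j)`. [cite: Milne1999, §6 p. 68 (proof of Corollary 6.6)] -/
theorem ones_mulVec [Fintype ι] (v : ι → R) : (ones : Matrix ι ι R) *ᵥ v = fun _ => ∑ j, v j := by
  ext i
  simp [Matrix.mulVec, dotProduct]

variable [Fintype ι] [DecidableEq ι]

/-- **`dE_n − I_n`**, the off-diagonal block of `A(n, d)`. [cite: Milne1999, §6 p. 67 («Some linear algebra»)] -/
def offBlock (d : R) : Matrix ι ι R := d • (ones : Matrix ι ι R) - 1

/-- `(dE_n − I_n)² = (nd² − 2d)E_n + I_n` (from `E_n² = nE_n`) — the computation behind «`A(n, d)` becomes `( I , dE − I ; 0 , (2d − nd²)E )`».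
[cite: Milne1999, §6 p. 68 (proof of Proposition 6.5)] -/
theorem offBlock_mul_offBlock (d : R) :
    offBlock (ι := ι) d * offBlock d = ((Fintype.card ι : R) * d ^ 2 - 2 * d) • (ones : Matrix ι ι R) + 1 := by
  simp only [offBlock, sub_mul, mul_sub, Matrix.mul_one, Matrix.one_mul, smul_mul_assoc, mul_smul_comm, ones_mul_ones, smul_smul]
  module

/-- **`A(n, d) = ( I_n , dE_n − I_n ; dE_n − I_n , I_n )`**, the `2n × 2n` matrix of «Some linear algebra», on the index set `ι ⊕ ι` (`n = |ι|`,
first summand = coordinates `x_1, …, x_n`, second = `x_{n+1}, …, x_{2n}`). [cite: Milne1999, §6 p. 67 («Some linear algebra»)] -/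
def matA (d : R) : Matrix (ι ⊕ ι) (ι ⊕ ι) R := Matrix.fromBlocks 1 (offBlock d) (offBlock d) 1

/-- **`B`**: the `n × n` matrix whose row `i₀` (Milne: the first row) is `(2d − nd², …, 2d − nd²)` and whose other rows are `0`.
[cite: Milne1999, §6 p. 68 Proposition 6.5] -/
def matB (d : R) (i₀ : ι) : Matrix ι ι R := Matrix.of fun i _ => if i = i₀ then 2 * d - (Fintype.card ι : R) * d ^ 2 else 0

/-- Entries of `B`. [cite: Milne1999, §6 p. 68 Proposition 6.5] -/
@[simp] theorem matB_apply (d : R) (i₀ i j : ι) :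
    matB d i₀ i j = if i = i₀ then 2 * d - (Fintype.card ι : R) * d ^ 2 else 0 := rfl

/-! ### PROPOSITION 6.5 — the row reduction, with the row operations explicit -/

/-- **First set of row operations** «to reduce the block at lower-left to zero»: subtract `(dE_n − I_n) ×` (the upper `n` rows) from the lower
`n` rows, i.e. left-multiply by the unimodular `( I , 0 ; −(dE − I) , I )`. [cite: Milne1999, §6 p. 68 (proof of Proposition 6.5)] -/
def lowerClear (d : R) : Matrix (ι ⊕ ι) (ι ⊕ ι) R := Matrix.fromBlocks 1 0 (-offBlock d) 1

/-- `lowerClear d` is unimodular (`det = 1`). [cite: Milne1999, §6 p. 68 (proof of Proposition 6.5)] -/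
theorem det_lowerClear (d : R) : (lowerClear (ι := ι) d).det = 1 := by
  rw [lowerClear, Matrix.det_fromBlocks_zero₁₂, Matrix.det_one, mul_one]

/-- **«After a set of row operations to reduce the block at lower-left to zero, `A(n, d)` becomes `( I_n , dE_n − I_n ; 0 , (2d − nd²)E_n )`»**.
[cite: Milne1999, §6 p. 68 (proof of Proposition 6.5)] -/
theorem lowerClear_mul_matA (d : R) :
    lowerClear d * matA (ι := ι) d =
      Matrix.fromBlocks 1 (offBlock d) 0 ((2 * d - (Fintype.card ι : R) * d ^ 2) • (ones : Matrix ι ι R)) := by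
  rw [lowerClear, matA, Matrix.fromBlocks_multiply]
  refine Matrix.fromBlocks_inj.mpr ⟨?_, ?_, ?_, ?_⟩
  · rw [Matrix.one_mul, Matrix.zero_mul, add_zero]
  · rw [Matrix.one_mul, Matrix.zero_mul, add_zero]
  · rw [Matrix.neg_mul, Matrix.mul_one, Matrix.one_mul, neg_add_cancel]
  · rw [Matrix.neg_mul, offBlock_mul_offBlock, Matrix.one_mul]
    module

/-- **Second set of row operations** («obviously row-equivalent»): subtract row `i₀` from every other row, i.e. left-multiply by the
unimodular `I_n − u e_{i₀}ᵀ` with `u_i = 1` for `i ≠ i₀`, `u_{i₀} = 0`. [cite: Milne1999, §6 p. 68 (proof of Proposition 6.5)] -/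
def rowCollapse (i₀ : ι) : Matrix ι ι R :=
  1 - Matrix.vecMulVec (fun i => if i = i₀ then (0 : R) else 1) (Pi.single i₀ 1)

omit [Fintype ι] in
/-- Entries of `rowCollapse i₀`: `δ_{ij} − [i ≠ i₀][j = i₀]`. [cite: Milne1999, §6 p. 68 (proof of Proposition 6.5)] -/
theorem rowCollapse_apply (i₀ i j : ι) :
    rowCollapse (R := R) i₀ i j = (if i = j then 1 else 0) - (if i = i₀ then 0 else 1) * (if j = i₀ then 1 else 0) := by
  simp only [rowCollapse, Matrix.sub_apply, Matrix.one_apply, Matrix.vecMulVec_apply, Pi.single_apply]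

/-- `rowCollapse i₀` is unimodular (`det = 1`; Mathlib's `det (1 + u vᵀ) = 1 + v · u`, here `v · u = u_{i₀} = 0`).
[cite: Milne1999, §6 p. 68 (proof of Proposition 6.5)] -/
theorem det_rowCollapse (i₀ : ι) : (rowCollapse (R := R) i₀).det = 1 := by
  rw [rowCollapse, sub_eq_add_neg, ← Matrix.neg_vecMulVec, Matrix.vecMulVec_eq (Fin 1),
    Matrix.det_one_add_replicateCol_mul_replicateRow, single_dotProduct]
  simp

/-- The second set of row operations applied to `cE_n` leaves `c` in row `i₀` and `0` elsewhere. [cite: Milne1999, §6 p. 68 (proof of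
Proposition 6.5)] -/
theorem rowCollapse_mul_smul_ones (i₀ : ι) (c : R) :
    rowCollapse i₀ * (c • (ones : Matrix ι ι R)) = Matrix.of fun i _ => if i = i₀ then c else 0 := by
  ext i j
  simp only [Matrix.mul_apply, rowCollapse_apply, Matrix.smul_apply, ones_apply, smul_eq_mul, mul_one, Matrix.of_apply, sub_mul,
    Finset.sum_sub_distrib, ite_mul, one_mul, zero_mul, Finset.sum_ite_eq, Finset.mem_univ, if_true, mul_ite, mul_zero,
    Finset.sum_ite_eq', mul_one]
  split_ifs <;> ring

/-- **The whole row reduction** `reducer d i₀ = ( I , 0 ; 0 , rowCollapse i₀ ) · lowerClear d`. [cite: Milne1999, §6 p. 68 (proof of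
Proposition 6.5)] -/
def reducer (d : R) (i₀ : ι) : Matrix (ι ⊕ ι) (ι ⊕ ι) R := Matrix.fromBlocks 1 0 0 (rowCollapse i₀) * lowerClear d

/-- `reducer d i₀` is unimodular (`det = 1`). [cite: Milne1999, §6 p. 68 Proposition 6.5] -/
theorem det_reducer (d : R) (i₀ : ι) : (reducer d i₀).det = 1 := by
  rw [reducer, Matrix.det_mul, det_lowerClear, Matrix.det_fromBlocks_zero₁₂, Matrix.det_one, det_rowCollapse, mul_one, mul_one]

/-- `reducer d i₀` is invertible. [cite: Milne1999, §6 p. 68 Proposition 6.5] -/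
theorem isUnit_reducer (d : R) (i₀ : ι) : IsUnit (reducer d i₀) := by
  rw [Matrix.isUnit_iff_isUnit_det, det_reducer]
  exact isUnit_one

/-- **PROPOSITION 6.5 (explicit form)**: `reducer d i₀ · A(n, d) = ( I_n , dE_n − I_n ; 0 , B )`. [cite: Milne1999, §6 p. 68 Proposition 6.5] -/
theorem reducer_mul_matA (d : R) (i₀ : ι) :
    reducer d i₀ * matA d = Matrix.fromBlocks 1 (offBlock d) 0 (matB d i₀) := by
  rw [reducer, Matrix.mul_assoc, lowerClear_mul_matA, Matrix.fromBlocks_multiply]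
  simp only [Matrix.one_mul, Matrix.mul_zero, add_zero, Matrix.zero_mul, zero_add, rowCollapse_mul_smul_ones, fromBlocks_inj,
    true_and]
  ext i j
  rfl

/-- **PROPOSITION 6.5**: «The matrix `A(n, d)` is row equivalent over `ℤ` to `( I_n , dE_n − I_n ; 0 , B )`» — there is a unimodular `P`
(`det P = 1`; explicitly `reducer d i₀`, a product of elementary row operations) with `P · A(n, d) = ( I_n , dE_n − I_n ; 0 , B )`; over any
commutative ring `R`, `n = |ι| ⩾ 1` witnessed by `i₀`. [cite: Milne1999, §6 p. 68 Proposition 6.5] -/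
theorem matA_rowEquiv (d : R) (i₀ : ι) :
    ∃ P : Matrix (ι ⊕ ι) (ι ⊕ ι) R, P.det = 1 ∧ P * matA d = Matrix.fromBlocks 1 (offBlock d) 0 (matB d i₀) :=
  ⟨reducer d i₀, det_reducer d i₀, reducer_mul_matA d i₀⟩

/-! ### COROLLARY 6.6 — the kernel of `x ↦ A(n, d)x` -/

/-- **The `2n` equations**: for `x = (a, b)`, `A(n, d)x = (a_i − b_i + dΣ_j b_j)_i ⊕ (b_i − a_i + dΣ_j a_j)_i`. [cite: Milne1999, §6 p. 68
(proof of Corollary 6.6)] -/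
theorem matA_mulVec (d : R) (v : ι ⊕ ι → R) :
    matA d *ᵥ v =
      Sum.elim (fun i => v (Sum.inl i) - v (Sum.inr i) + d * ∑ j, v (Sum.inr j))
        (fun i => v (Sum.inr i) - v (Sum.inl i) + d * ∑ j, v (Sum.inl j)) := by
  ext (i | i)
  · simp only [matA, Matrix.fromBlocks_mulVec, Sum.elim_inl, Matrix.one_mulVec, offBlock, Matrix.sub_mulVec,
      Matrix.smul_mulVec, ones_mulVec, Pi.add_apply, Pi.sub_apply, Pi.smul_apply, Function.comp_apply, smul_eq_mul]
    ring
  · simp only [matA, Matrix.fromBlocks_mulVec, Sum.elim_inr, Matrix.one_mulVec, offBlock, Matrix.sub_mulVec,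
      Matrix.smul_mulVec, ones_mulVec, Pi.add_apply, Pi.sub_apply, Pi.smul_apply, Function.comp_apply, smul_eq_mul]
    ring

/-- **COROLLARY 6.6**: «Assume `d(2 − nd) ≠ 0`. Then the kernel of the map `x ↦ A(n, d)x` is the set of vectors of the form
`(a_1, …, a_n, b_1, …, b_n)`, `a_i = b_i` for `1 ⩽ i ⩽ n`, `Σ a_i = 0`» — over any commutative ring without zero divisors.
[cite: Milne1999, §6 p. 68 Corollary 6.6] -/
theorem matA_mulVec_eq_zero_iff [NoZeroDivisors R] {d : R} (hd : d * (2 - (Fintype.card ι : R) * d) ≠ 0) (v : ι ⊕ ι → R) :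
    matA d *ᵥ v = 0 ↔ (∀ i, v (Sum.inl i) = v (Sum.inr i)) ∧ ∑ i, v (Sum.inl i) = 0 := by
  have hd0 : d ≠ 0 := fun h => hd (by rw [h, zero_mul])
  have h2 : (2 - (Fintype.card ι : R) * d) ≠ 0 := fun h => hd (by rw [h, mul_zero])
  rw [matA_mulVec]
  constructor
  · intro h
    have ha : ∀ i, v (Sum.inl i) - v (Sum.inr i) + d * ∑ j, v (Sum.inr j) = 0 := fun i => by
      simpa using congr_fun h (Sum.inl i)
    have hb : ∀ i, v (Sum.inr i) - v (Sum.inl i) + d * ∑ j, v (Sum.inl j) = 0 := fun i => by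
      simpa using congr_fun h (Sum.inr i)
    rcases isEmpty_or_nonempty ι with hι | ⟨⟨i₁⟩⟩
    · exact ⟨fun i => (IsEmpty.false i).elim, by simp⟩
    -- add the `i₁`-th equations of the two blocks: `d(Σa + Σb) = 0`, so `Σb = −Σa`
    have hsum : (∑ j, v (Sum.inr j)) = -∑ j, v (Sum.inl j) := by
      have e : d * (∑ j, v (Sum.inl j) + ∑ j, v (Sum.inr j)) = 0 := by
        have := congrArg₂ (· + ·) (ha i₁) (hb i₁)
        simp only [add_zero] at this
        rw [← this]
        ring
      rcases mul_eq_zero.mp e with e | e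
      · exact (hd0 e).elim
      · exact eq_neg_of_add_eq_zero_right e
    -- sum the first block over `i`: `Σa − Σb + ndΣb = 0`, i.e. `(2 − nd)Σa = 0`
    have hblock : (∑ i, (v (Sum.inl i) - v (Sum.inr i) + d * ∑ j, v (Sum.inr j))) = 0 :=
      Finset.sum_eq_zero fun i _ => ha i
    rw [Finset.sum_add_distrib, Finset.sum_sub_distrib, Finset.sum_const, Finset.card_univ, nsmul_eq_mul, hsum] at hblock
    have hsa : (2 - (Fintype.card ι : R) * d) * ∑ j, v (Sum.inl j) = 0 := by
      rw [← hblock]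
      ring
    have hsa' : ∑ j, v (Sum.inl j) = 0 := by
      rcases mul_eq_zero.mp hsa with e | e
      · exact (h2 e).elim
      · exact e
    refine ⟨fun i => ?_, hsa'⟩
    have := ha i
    rw [hsum, hsa', neg_zero, mul_zero, add_zero] at this
    exact sub_eq_zero.mp this
  · rintro ⟨hab, hsa⟩
    have hsb : ∑ j, v (Sum.inr j) = 0 := by
      rw [← hsa]
      exact Finset.sum_congr rfl fun i _ => (hab i).symm
    ext (i | i)
    · simp [hab i, hsb]
    · simp [hab i, hsa]

/-- **COROLLARY 6.6, «vectors of the form …»**: under `d(2 − nd) ≠ 0`, `A(n, d)x = 0 ⟺ x = (a, a)` for some `a` with `Σ a_i = 0`.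
[cite: Milne1999, §6 p. 68 Corollary 6.6] -/
theorem matA_mulVec_eq_zero_iff' [NoZeroDivisors R] {d : R} (hd : d * (2 - (Fintype.card ι : R) * d) ≠ 0) (v : ι ⊕ ι → R) :
    matA d *ᵥ v = 0 ↔ ∃ a : ι → R, ∑ i, a i = 0 ∧ v = Sum.elim a a := by
  rw [matA_mulVec_eq_zero_iff hd]
  constructor
  · rintro ⟨hab, hsa⟩
    refine ⟨fun i => v (Sum.inl i), hsa, ?_⟩
    ext (i | i)
    · rfl
    · exact (hab i).symm
  · rintro ⟨a, ha, rfl⟩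
    exact ⟨fun _ => rfl, ha⟩

/-- The submodule `{(a, b) | a_i = b_i ∀ i, Σ a_i = 0}` of `R^{ι ⊕ ι}` — the printed description of the kernel. [cite: Milne1999, §6 p. 68
Corollary 6.6] -/
def kerSubmodule (ι : Type*) [Fintype ι] (R : Type*) [CommRing R] : Submodule R (ι ⊕ ι → R) where
  carrier := {v | (∀ i, v (Sum.inl i) = v (Sum.inr i)) ∧ ∑ i, v (Sum.inl i) = 0}
  add_mem' := by
    rintro v w ⟨hv, hv'⟩ ⟨hw, hw'⟩
    refine ⟨fun i => by rw [Pi.add_apply, Pi.add_apply, hv i, hw i], ?_⟩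
    simp only [Pi.add_apply, Finset.sum_add_distrib, hv', hw', add_zero]
  zero_mem' := ⟨fun _ => rfl, by simp⟩
  smul_mem' := by
    rintro c v ⟨hv, hv'⟩
    refine ⟨fun i => by rw [Pi.smul_apply, Pi.smul_apply, hv i], ?_⟩
    simp only [Pi.smul_apply, smul_eq_mul, ← Finset.mul_sum, hv', mul_zero]

omit [DecidableEq ι] in
/-- Membership in `kerSubmodule`. [cite: Milne1999, §6 p. 68 Corollary 6.6] -/
@[simp] theorem mem_kerSubmodule (v : ι ⊕ ι → R) :
    v ∈ kerSubmodule ι R ↔ (∀ i, v (Sum.inl i) = v (Sum.inr i)) ∧ ∑ i, v (Sum.inl i) = 0 := Iff.rfl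

/-- **COROLLARY 6.6 (as an equality of submodules)**: under `d(2 − nd) ≠ 0`, `Ker (x ↦ A(n, d)x) = {(a, b) | a = b, Σ a_i = 0}`.
[cite: Milne1999, §6 p. 68 Corollary 6.6] -/
theorem ker_mulVecLin_matA [NoZeroDivisors R] {d : R} (hd : d * (2 - (Fintype.card ι : R) * d) ≠ 0) :
    LinearMap.ker (Matrix.mulVecLin (matA (ι := ι) d)) = kerSubmodule ι R := by
  ext v
  rw [LinearMap.mem_ker, Matrix.mulVecLin_apply, mem_kerSubmodule, matA_mulVec_eq_zero_iff hd]

/-- **COROLLARY 6.6 exactly as printed** (`ℤ^{2n}`, `n ⩾ 0`, `d ∈ ℤ` with `d(2 − nd) ≠ 0`): `A(n, d)x = 0 ⟺ a_i = b_i` for all `i` and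
`Σ a_i = 0`, where `x = (a, b) ∈ ℤ^n ⊕ ℤ^n`. [cite: Milne1999, §6 p. 68 Corollary 6.6] -/
theorem int_matA_mulVec_eq_zero_iff (n : ℕ) {d : ℤ} (hd : d * (2 - n * d) ≠ 0) (v : Fin n ⊕ Fin n → ℤ) :
    matA d *ᵥ v = 0 ↔ (∀ i, v (Sum.inl i) = v (Sum.inr i)) ∧ ∑ i, v (Sum.inl i) = 0 :=
  matA_mulVec_eq_zero_iff (by rwa [Fintype.card_fin]) v

end BlockOnesMatrix

end Literature.NumberTheory.ComplexMultiplication
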